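import Literature.AlgebraicGeometry.HodgeTheory.AbelianVarietyCotangentHodge
import Literature.AlgebraicGeometry.HodgeTheory.AbelianVarietyCotangentDifferential
import Literature.AlgebraicGeometry.HodgeTheory.AbelianVarietyCotangentDifferentialEquivariance
import Literature.AlgebraicGeometry.HodgeTheory.AbelianVarietyHodgeOneZeroDual
import Literature.AlgebraicGeometry.HodgeTheory.AbelianVarietyHodgeFullnessHolds
import Literature.NumberTheory.ComplexMultiplication.RationalInvariantFormsOfUniformisation
import HarnessLib

/-!
# `cotangent_hodge10_comparison` HOLDS: `H^{1,0}(B) ≅ T_e^*(B)`, `End(B)`-equivariantly, for every complex abelian variety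

Family `hodge`, layer `Literature/AlgebraicGeometry/HodgeTheory`.  THEOREMS ONLY; net named-fact debt
−1: the named fact `cotangent_hodge10_comparison` (`AbelianVarietyCotangentHodge.lean`, p300740 —
[LangeBirkenhake1992] §1.1.5 (1.6), Lemma 1.1.22, Thm. 1.1.21 with §1.1.2 Cor. 1.1.7: «the analytic
representation `ρ_a(f)` coincides with the differential `df|_0`», so that `f^*` on
`H^{1,0}(X) = H⁰(Ω¹_X) ≅ Ω¹_{X,0}` is the cotangent map of `f`) becomes the theorem
`cotangent_hodge10_comparison_holds`.

PROOF (TRACK 2 of TEAM hCMisogE, four files; this one is the assembly).  Uniformise `B` by a complex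
torus `φ : E/Φ(ℤ^ι) → B(ℂ)`, `E = ℂ^{dim B}` (`complexAbelianVariety_torusUniformised_holds`,
[Shimura1998] §3.1, [LangeBirkenhake1992] Lemma 1.1.2).  Then
* (T2-0) every endomorphism `g` of `B` is, on the torus, the homomorphism `mapMatrix A` of an integer
  matrix with `ℂ`-LINEAR analytic representation `L = ρ_a(g)`
  (`NumberTheory.ComplexMultiplication.exists_rationalRep_analyticRep`: GAGA functoriality +
  [LangeBirkenhake1992] Prop. 1.1.6);
* (T2-a/b) the differential at the origin `Ψ₀ : T_e^*(B) = 𝔪_e/𝔪_e² ≃ E^*`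
  (`HodgeTheory.AbelianVariety.exists_cotangentDifferential`: GAGA at a point, Serre §2 n°6 Prop. 3
  Cor. 2, and `dim 𝔪_e/𝔪_e² = dim B`);
* (T2-c) `Ψ₀ ∘ T_e^*(g) = (· ∘ L) ∘ Ψ₀` (`cotangentDifferential_cotangentMap`: the chain rule at `0`,
  [LangeBirkenhake1992] Cor. 1.1.7);
* (T2-d) `Ξ : E^* ≃ W = H^{1,0}(B)` with `Ξ (ℓ ∘ L) = g^* (Ξ ℓ)` (`exists_hodgeOneZeroDual`: the
  `(1,0)`-classes in canonical lattice coordinates are the period rows of `ℂ`-linear functionals,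
  `complexTorus_latticeCoordHOne_hodgeOneZero_holds`, [LangeBirkenhake1992] Thm. 1.1.21, and
  `g^* = Aᵀ` there, Lemma 1.1.17, Prop. 1.1.9);
so `Ψ := Ξ ∘ Ψ₀ : T_e^*(B) ≃ W` satisfies `Ψ (T_e^*(g) t) = g^* (Ψ t)` — both sides are
precomposition with the SAME `L`.

Consequence for the COR-CM chain: the END display's binder `hW : cotangent_hodge10_comparison`
(TEAM hCMisogE, `Transposition/Item6PinMatchDef45*.lean`) is discharged BY NAME:
`hW := cotangent_hodge10_comparison_holds`; and the corollaries of `AbelianVarietyCotangentHodge.lean`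
hold unconditionally (`det_restrict_hodgeOneZero_eq_det_cotangentMap_holds` below).

## References

* [LangeBirkenhake1992] H. Lange, Ch. Birkenhake, *Complex Abelian Varieties* (1992), §1.1.1
  Lemma 1.1.2; §1.1.2 Prop. 1.1.6, Cor. 1.1.7, Prop. 1.1.9; §1.1.3 Lemma 1.1.17; §1.1.5 (1.6),
  Lemma 1.1.22, Thm. 1.1.21.
* [SerreGAGA1956] J.-P. Serre, *Géométrie algébrique et géométrie analytique* (1956), §2 n°5 Prop. 2,
  n°6 Prop. 3 Cor. 2.
* [Shimura1998] G. Shimura, *Abelian Varieties with Complex Multiplication and Modular Functions*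
  (1998), §2.6 Prop. 3, §2.8, §3.1–3.2.

## Provenance

pub-hodgecm2 TEAM hCMisogE TRACK 2: hcmisog-lie-2 (lead; T2-a/b, T2-e), tr-prover-1 (T2-c),
hcmisog-lie-1 (T2-d); lead GO 2026-08-21 l.5275.  HC_CM is NOT proved; this file removes one cited
hypothesis from its conditional display, nothing more.
-/

noncomputable section

open CategoryTheory AlgebraicGeometry
open scoped Manifold ContDiff
open Literature.Geometry.Kaehler (ComplexTorus)
open Literature.NumberTheory.Transcendental (IsAnalytification)
open Literature.NumberTheory.ComplexMultiplication (exists_rationalRep_analyticRep)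
open Literature.AlgebraicGeometry.Motives (AbelianVariety)

namespace Literature.AlgebraicGeometry.HodgeTheory

/-- **`H^{1,0}(B) ≅ T_e^*(B)`, `End(B)`-equivariantly, for every complex abelian variety `B`**
(Lange–Birkenhake 1992 §1.1.5 (1.6), Lemma 1.1.22, Thm. 1.1.21: `H^{1,0}(X) = H⁰(Ω¹_X) ≅ Ω =
Hom_ℂ(V, ℂ) = Ω¹_{X,0}`; §1.1.2 Cor. 1.1.7: the analytic representation is the differential at `0`,
so the pull-back `f^*` on `H^{1,0}` is the cotangent map `(df|_0)^*`): the named fact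
`cotangent_hodge10_comparison` HOLDS — for every `B` and the `(1,0)`-classes
`W ⊆ H¹(B(ℂ); ℂ)` there is ONE `ℂ`-linear isomorphism `Ψ : Cotangent B ≃ W` with
`Ψ (cotangentMap B g t) = g^* (Ψ t)` for every endomorphism `g`.  Proof: `Ψ := Ξ ∘ Ψ₀` with `Ψ₀` the
differential at the origin along the torus uniformisation and `Ξ` the period-row isomorphism
`E^* ≅ W`; both intertwine `g` with precomposition by its analytic representation `L`.
[cite: LangeBirkenhake1992, §1.1.2 Corollary 1.1.7 and §1.1.5 (1.6), Lemma 1.1.22, Theorem 1.1.21]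
[cite: SerreGAGA1956, §2 n°6 Prop. 3 Cor. 2] [cite: Shimura1998, §2.6 Prop. 3, §2.8 and §3.2] -/
theorem cotangent_hodge10_comparison_holds : cotangent_hodge10_comparison := by
  classical
  intro B W hW
  obtain ⟨ι, _, _, Φ, φ, hφ, hφadd⟩ := complexAbelianVariety_torusUniformised_holds B
  obtain ⟨Ψ₀, hΨ₀⟩ := AbelianVariety.exists_cotangentDifferential hφ hφadd
  obtain ⟨Ξ, hΞ⟩ := exists_hodgeOneZeroDual hφ hW
  refine ⟨Ψ₀.trans Ξ, fun g t => ?_⟩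
  obtain ⟨A, L, hAL, hcomm⟩ := exists_rationalRep_analyticRep Φ hφ hφadd g
  have h1 : Ψ₀ (Motives.AbelianVariety.cotangentMap B g t) = (Ψ₀ t).comp L :=
    cotangentDifferential_cotangentMap hφ hφadd Ψ₀.toLinearMap
      (fun U hU s hs => hΨ₀ U hU s hs) g A L hAL hcomm t
  rw [LinearEquiv.trans_apply, LinearEquiv.trans_apply, h1, hΞ g A L hAL hcomm (Ψ₀ t)]

/-! ### Unconditional forms of the corollaries of `AbelianVarietyCotangentHodge.lean` -/

/-- **`det (g^*|_{H^{1,0}(B)}) = det T_e^*(g)`** for every endomorphism `g` of a complex abelian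
variety, UNCONDITIONALLY (`det_restrict_hodgeOneZero_eq_det_cotangentMap` at
`cotangent_hodge10_comparison_holds`). [cite: LangeBirkenhake1992, §1.1.2 Corollary 1.1.7 and §1.1.5 (1.6)] -/
theorem det_restrict_hodgeOneZero_eq_det_cotangentMap_holds (B : AbelianVariety ℂ) (g : B ⟶ B) :
    LinearMap.det ((complexBetti.map g.hom.hom.hom 1).hom.restrict fun _ hv =>
        map_mem_hodgeOneZero (Motives.AbelianVariety.isSmoothProjective_holds (A := B)) g.hom.hom.hom hv) =
      LinearMap.det (Motives.AbelianVariety.cotangentMap B g) :=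
  cotangent_hodge10_comparison.det_restrict_hodgeOneZero_eq_det_cotangentMap
    cotangent_hodge10_comparison_holds B g

/-- **`det (f_ℂ^*|_{H^{1,0}(A_ℂ)}) = σ (det_E T_e^*(f))`** for an abelian variety `A` over a field `E`
with `[Algebra E ℂ]` (the pin `σ = algebraMap E ℂ`), an endomorphism `f` and a base-change comparison
`χ` of cotangent spaces compatible with `f` — UNCONDITIONALLY in the Hodge comparison.
[cite: LangeBirkenhake1992, §1.1.2 Corollary 1.1.7 and §1.1.5 (1.6)] -/
theorem det_restrict_hodgeOneZero_baseChange_eq_algebraMap_det_cotangentMap_holds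
    {E : Type} [Field E] [Algebra E ℂ] (A : AbelianVariety E)
    (χ : TensorProduct E ℂ (Motives.AbelianVariety.Cotangent A) ≃ₗ[ℂ]
      Motives.AbelianVariety.Cotangent (A.baseChange ℂ))
    (f : A ⟶ A)
    (hχ : ∀ t, χ ((Motives.AbelianVariety.cotangentMap A f).baseChange ℂ t) =
      Motives.AbelianVariety.cotangentMap (A.baseChange ℂ) (Motives.AbelianVariety.Hom.baseChange ℂ f)
        (χ t)) :
    LinearMap.det ((complexBetti.map (Motives.AbelianVariety.Hom.baseChange ℂ f).hom.hom.hom 1).hom.restrict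
        fun _ hv => map_mem_hodgeOneZero
          (Motives.AbelianVariety.isSmoothProjective_holds (A := A.baseChange ℂ))
          (Motives.AbelianVariety.Hom.baseChange ℂ f).hom.hom.hom hv) =
      algebraMap E ℂ (LinearMap.det (Motives.AbelianVariety.cotangentMap A f)) :=
  cotangent_hodge10_comparison.det_restrict_hodgeOneZero_baseChange_eq_algebraMap_det_cotangentMap
    cotangent_hodge10_comparison_holds A χ f hχ

end Literature.AlgebraicGeometry.HodgeTheory

end
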